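import Mathlib
import HarnessLib
import Literature.NumberTheory.DiophantineGeometry.SquarefulSumsConics
import Literature.NumberTheory.DiophantineGeometry.ConicParametrisationAlgebra

/-!
# `conicTriples y B` as signed primitive solutions of `aX² + bY² = cZ²`

For `y = (a, b, c)` with `abc` square-free, the points of `conicTriples y B` (Browning–Van
Valckenborgh 2012, (1.1): `x ∈ ℕ³` with `x₀²a³ + x₁²b³ = x₂²c³`, coprimality, `x₂²c³ ≤ B`)
correspond, through `(X, Y, Z) = (a x₀, b x₁, c x₂)` and the `8` sign choices, to the primitive
integer zeros `(X, Y, Z)` of `aX² + bY² − cZ²` with `XYZ ≠ 0`, `a ∣ X`, `b ∣ Y`, `c ∣ Z`,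
`cZ² ≤ B`: `ncard_signedSolutions` — the latter set has exactly `8 · #conicTriples y B` elements.
(`isCoprime_of_primitive_zero`: a primitive zero has `gcd(aX², bY²) = 1`.) Everything is proved.

## References

* T. D. Browning, K. Van Valckenborgh, *Sums of three squareful numbers*, Exp. Math. 21 (2012),
  §1 (1.1), §2 (2.1). [cite: BrowningValckenborgh2012, §1 (1.1)]
-/

namespace Literature.NumberTheory.DiophantineGeometry

open Finset

/-- **A primitive zero of `aX² + bY² − cZ²` (`abc` square-free) has `gcd(aX², bY²) = 1`.**
[folklore] -/
theorem isCoprime_of_primitive_zero {a b c : ℕ} (hd : Squarefree (a * b * c)) {x : ℤ × ℤ × ℤ}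
    (hx : ternForm ((a : ℤ), (b : ℤ), -(c : ℤ)) x = 0) (hxc : content3 x = 1) :
    IsCoprime ((a : ℤ) * x.1 ^ 2) ((b : ℤ) * x.2.1 ^ 2) := by
  simp only [ternForm] at hx
  have heq : (a : ℤ) * x.1 ^ 2 + (b : ℤ) * x.2.1 ^ 2 = (c : ℤ) * x.2.2 ^ 2 := by linear_combination hx
  have hsq2 : ∀ u w : ℕ, Squarefree (u * w) → ∀ p, p.Prime → p ∣ u → ¬p ∣ w := by
    intro u w huw p hp hu hw
    have : p * p ∣ u * w := mul_dvd_mul hu hw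
    exact hp.ne_one (by simpa using huw p this)
  have hab : Squarefree (a * b) := Squarefree.of_mul_left hd
  have hac : Squarefree (a * c) := hd.squarefree_of_dvd ⟨b, by ring⟩
  have hbc : Squarefree (b * c) := Squarefree.of_mul_right (by rwa [mul_assoc] at hd)
  -- a prime `p` cannot divide `x₀, x₁` simultaneously, nor `v_p` of a coefficient twice
  have hsqf : ∀ u : ℕ, Squarefree u → ∀ p : ℕ, p.Prime → (p : ℤ) ∣ (u : ℤ) → ∀ z : ℤ,
      (p : ℤ) ^ 2 ∣ (u : ℤ) * z ^ 2 → (p : ℤ) ∣ z := by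
    intro u hu p hp hpu z h2
    have hp' : Prime (p : ℤ) := Nat.prime_iff_prime_int.1 hp
    obtain ⟨u', hu'⟩ := hpu
    rw [hu', pow_two, mul_assoc] at h2
    have h3 : (p : ℤ) ∣ u' * z ^ 2 := (mul_dvd_mul_iff_left (by exact_mod_cast hp.ne_zero)).1 h2
    rcases hp'.dvd_or_dvd h3 with h | h
    · exfalso
      have : p * p ∣ u := by
        have : ((p * p : ℕ) : ℤ) ∣ (u : ℤ) := by rw [hu']; push_cast; exact mul_dvd_mul_left _ h
        exact_mod_cast this
      exact hp.ne_one (by simpa using hu p this)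
    · exact hp'.dvd_of_dvd_pow h
  rw [Int.isCoprime_iff_gcd_eq_one]
  by_contra hg
  obtain ⟨p, hp, hpg⟩ := Nat.exists_prime_and_dvd hg
  have hp' : Prime (p : ℤ) := Nat.prime_iff_prime_int.1 hp
  have h1 : (p : ℤ) ∣ (a : ℤ) * x.1 ^ 2 := (Int.natCast_dvd_natCast.2 hpg).trans (Int.gcd_dvd_left _ _)
  have h2 : (p : ℤ) ∣ (b : ℤ) * x.2.1 ^ 2 := (Int.natCast_dvd_natCast.2 hpg).trans (Int.gcd_dvd_right _ _)
  have hcontent : ¬((p : ℤ) ∣ x.1 ∧ (p : ℤ) ∣ x.2.1 ∧ (p : ℤ) ∣ x.2.2) := by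
    rintro ⟨g1, g2, g3⟩
    have : p ∣ content3 x := dvd_content3 g1 g2 g3
    rw [hxc] at this
    exact hp.ne_one (Nat.dvd_one.1 this)
  -- case `p ∣ x₀` and `p ∣ x₁`: then `p ∣ x₂`
  have hXY : (p : ℤ) ∣ x.1 → (p : ℤ) ∣ x.2.1 → False := by
    intro gX gY
    have g2 : (p : ℤ) ^ 2 ∣ (c : ℤ) * x.2.2 ^ 2 := by
      rw [← heq, pow_two]
      exact Int.dvd_add ((mul_dvd_mul gX gX).mul_left _ |>.trans (by rw [pow_two]))
        ((mul_dvd_mul gY gY).mul_left _ |>.trans (by rw [pow_two]))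
    have gZ2 : (p : ℤ) ∣ (c : ℤ) * x.2.2 ^ 2 := (dvd_pow_self (p : ℤ) two_ne_zero).trans g2
    rcases hp'.dvd_or_dvd gZ2 with h | h
    · exact hcontent ⟨gX, gY, hsqf c (Squarefree.of_mul_right hd) p hp h _ g2⟩
    · exact hcontent ⟨gX, gY, hp'.dvd_of_dvd_pow h⟩
  -- case `p ∣` a coefficient
  have hcoef : ∀ (u w w' : ℕ) (X Y Z : ℤ), Squarefree (u * w) → Squarefree (u * w') → Squarefree u →
      (u : ℤ) * X ^ 2 = (w' : ℤ) * Z ^ 2 - (w : ℤ) * Y ^ 2 → (p : ℤ) ∣ (u : ℤ) → ¬(p : ℤ) ∣ X →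
      (p : ℤ) ∣ (w : ℤ) * Y ^ 2 → ((p : ℤ) ∣ Y → (p : ℤ) ∣ Z → False) → False := by
    intro u w w' X Y Z huw huw' hu hrel hpu hpX hwY hYZ
    have hw : ¬(p : ℤ) ∣ (w : ℤ) := fun h => hsq2 u w huw p hp (Int.natCast_dvd_natCast.1 hpu)
      (Int.natCast_dvd_natCast.1 h)
    have hw' : ¬(p : ℤ) ∣ (w' : ℤ) := fun h => hsq2 u w' huw' p hp (Int.natCast_dvd_natCast.1 hpu)
      (Int.natCast_dvd_natCast.1 h)
    have gY : (p : ℤ) ∣ Y := by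
      rcases hp'.dvd_or_dvd hwY with h | h
      · exact absurd h hw
      · exact hp'.dvd_of_dvd_pow h
    have gZ : (p : ℤ) ∣ Z := by
      have : (p : ℤ) ∣ (w' : ℤ) * Z ^ 2 := by
        have e : (w' : ℤ) * Z ^ 2 = (u : ℤ) * X ^ 2 + (w : ℤ) * Y ^ 2 := by linear_combination -hrel
        rw [e]; exact Int.dvd_add (hpu.mul_right _) hwY
      rcases hp'.dvd_or_dvd this with h | h
      · exact absurd h hw'
      · exact hp'.dvd_of_dvd_pow h
    exact hYZ gY gZ
  rcases hp'.dvd_or_dvd h1 with hpa | hpX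
  · by_cases gX : (p : ℤ) ∣ x.1
    · -- then `p ∣ x₁` too
      have hb : ¬(p : ℤ) ∣ (b : ℤ) := fun h => hsq2 a b hab p hp (Int.natCast_dvd_natCast.1 hpa)
        (Int.natCast_dvd_natCast.1 h)
      rcases hp'.dvd_or_dvd h2 with h | h
      · exact hb h
      · exact hXY gX (hp'.dvd_of_dvd_pow h)
    · refine hcoef a b c x.1 x.2.1 x.2.2 hab hac (Squarefree.of_mul_left hab) (by linear_combination hx)
        hpa gX h2 fun gY gZ => ?_
      -- `p² ∣ a x₀²` with `p ∤ x₀`: contradiction with `a` square-free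
      have g2 : (p : ℤ) ^ 2 ∣ (a : ℤ) * x.1 ^ 2 := by
        have e : (a : ℤ) * x.1 ^ 2 = (c : ℤ) * x.2.2 ^ 2 - (b : ℤ) * x.2.1 ^ 2 := by linear_combination hx
        rw [e, pow_two]
        exact Int.dvd_sub ((mul_dvd_mul gZ gZ).mul_left _ |>.trans (by rw [pow_two]))
          ((mul_dvd_mul gY gY).mul_left _ |>.trans (by rw [pow_two]))
      exact gX (hsqf a (Squarefree.of_mul_left hab) p hp hpa _ g2)
  · have gX : (p : ℤ) ∣ x.1 := hp'.dvd_of_dvd_pow hpX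
    rcases hp'.dvd_or_dvd h2 with hpb | hpY
    · by_cases gY : (p : ℤ) ∣ x.2.1
      · exact hXY gX gY
      · have hba : Squarefree (b * a) := by rwa [mul_comm] at hab
        refine hcoef b a c x.2.1 x.1 x.2.2 hba hbc (Squarefree.of_mul_right hab) (by linear_combination hx)
          hpb gY h1 fun gX' gZ => ?_
        · have g2 : (p : ℤ) ^ 2 ∣ (b : ℤ) * x.2.1 ^ 2 := by
            have e : (b : ℤ) * x.2.1 ^ 2 = (c : ℤ) * x.2.2 ^ 2 - (a : ℤ) * x.1 ^ 2 := by linear_combination hx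
            rw [e, pow_two]
            exact Int.dvd_sub ((mul_dvd_mul gZ gZ).mul_left _ |>.trans (by rw [pow_two]))
              ((mul_dvd_mul gX' gX').mul_left _ |>.trans (by rw [pow_two]))
          exact gY (hsqf b (Squarefree.of_mul_right hab) p hp hpb _ g2)
    · exact hXY gX (hp'.dvd_of_dvd_pow hpY)

/-- The sign set `{±1}³ ⊆ ℤ³` has `8` elements. [folklore] -/
theorem ncard_signs :
    ({ε : ℤ × ℤ × ℤ | (ε.1 = 1 ∨ ε.1 = -1) ∧ (ε.2.1 = 1 ∨ ε.2.1 = -1) ∧ (ε.2.2 = 1 ∨ ε.2.2 = -1)}).ncard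
      = 8 := by
  have hpair : ({1, -1} : Set ℤ).ncard = 2 := Set.ncard_pair (by norm_num)
  have hset : {ε : ℤ × ℤ × ℤ | (ε.1 = 1 ∨ ε.1 = -1) ∧ (ε.2.1 = 1 ∨ ε.2.1 = -1) ∧ (ε.2.2 = 1 ∨ ε.2.2 = -1)}
      = ({1, -1} : Set ℤ) ×ˢ (({1, -1} : Set ℤ) ×ˢ ({1, -1} : Set ℤ)) := by
    ext ε; simp [Set.mem_prod]
  rw [hset, Set.ncard_prod, Set.ncard_prod, hpair]

/-- **`#` signed primitive solutions `= 8 · #conicTriples`.** For `y = (a,b,c)` with `abc`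
square-free, the primitive zeros `(X,Y,Z) ∈ ℤ³` of `aX² + bY² − cZ²` with `XYZ ≠ 0`, `a ∣ X`,
`b ∣ Y`, `c ∣ Z` and `cZ² ≤ B` number exactly `8 · #conicTriples y B` (through
`(X,Y,Z) = (±a x₀, ±b x₁, ±c x₂)`). [cite: BrowningValckenborgh2012, §1 (1.1), §2 (2.1)] -/
theorem ncard_signedSolutions {a b c : ℕ} (hd : Squarefree (a * b * c)) (B : ℕ) :
    {x : ℤ × ℤ × ℤ | ternForm ((a : ℤ), (b : ℤ), -(c : ℤ)) x = 0 ∧ content3 x = 1 ∧ x.1 ≠ 0 ∧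
        x.2.1 ≠ 0 ∧ x.2.2 ≠ 0 ∧ (a : ℤ) ∣ x.1 ∧ (b : ℤ) ∣ x.2.1 ∧ (c : ℤ) ∣ x.2.2 ∧
        (c : ℤ) * x.2.2 ^ 2 ≤ B}.ncard = 8 * (conicTriples (a, b, c) B).ncard := by
  have habc : a * b * c ≠ 0 := hd.ne_zero
  have ha : a ≠ 0 := by rintro rfl; simp at habc
  have hb : b ≠ 0 := by rintro rfl; simp at habc
  have hc : c ≠ 0 := by rintro rfl; simp at habc
  have ha' : (a : ℤ) ≠ 0 := by exact_mod_cast ha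
  have hb' : (b : ℤ) ≠ 0 := by exact_mod_cast hb
  have hc' : (c : ℤ) ≠ 0 := by exact_mod_cast hc
  set Signs : Set (ℤ × ℤ × ℤ) := {ε | (ε.1 = 1 ∨ ε.1 = -1) ∧ (ε.2.1 = 1 ∨ ε.2.1 = -1) ∧
    (ε.2.2 = 1 ∨ ε.2.2 = -1)} with hSigns
  set T := conicTriples (a, b, c) B with hT
  set S : Set (ℤ × ℤ × ℤ) := {x | ternForm ((a : ℤ), (b : ℤ), -(c : ℤ)) x = 0 ∧ content3 x = 1 ∧
    x.1 ≠ 0 ∧ x.2.1 ≠ 0 ∧ x.2.2 ≠ 0 ∧ (a : ℤ) ∣ x.1 ∧ (b : ℤ) ∣ x.2.1 ∧ (c : ℤ) ∣ x.2.2 ∧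
    (c : ℤ) * x.2.2 ^ 2 ≤ B} with hS
  set Φ : (ℤ × ℤ × ℤ) × (ℕ × ℕ × ℕ) → ℤ × ℤ × ℤ := fun q =>
    (q.1.1 * (a * q.2.1 : ℕ), q.1.2.1 * (b * q.2.2.1 : ℕ), q.1.2.2 * (c * q.2.2.2 : ℕ)) with hΦ
  -- signs square to one and are units
  have hsq : ∀ e : ℤ, (e = 1 ∨ e = -1) → e ^ 2 = 1 := by
    rintro e (rfl | rfl) <;> norm_num
  have habs : ∀ e : ℤ, (e = 1 ∨ e = -1) → ∀ n : ℕ, (e * n).natAbs = n := by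
    rintro e (rfl | rfl) n <;> simp
  -- (1) `Φ` maps `Signs × T` into `S`
  have hinto : ∀ q ∈ Signs ×ˢ T, Φ q ∈ S := by
    rintro ⟨ε, t⟩ ⟨hε, ht⟩
    obtain ⟨h1, h2, h3⟩ := hε
    obtain ⟨⟨p0, p1, hsum, hcop⟩, hB⟩ := ht
    simp only at p0 p1 hsum hcop hB
    have t0 : 0 < t.1 := Nat.pos_of_ne_zero fun h => by simp [h] at p0
    have t1 : 0 < t.2.1 := Nat.pos_of_ne_zero fun h => by simp [h] at p1
    have t2 : 0 < t.2.2 := Nat.pos_of_ne_zero fun h => by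
      rw [h] at hsum; simp at hsum; omega
    simp only [hS, Set.mem_setOf_eq, hΦ]
    refine ⟨?_, ?_, ?_, ?_, ?_, ⟨ε.1 * t.1, by push_cast; ring⟩, ⟨ε.2.1 * t.2.1, by push_cast; ring⟩,
      ⟨ε.2.2 * t.2.2, by push_cast; ring⟩, ?_⟩
    · simp only [ternForm]
      push_cast
      have hsum' : ((t.1 ^ 2 * a ^ 3 + t.2.1 ^ 2 * b ^ 3 : ℕ) : ℤ) = ((t.2.2 ^ 2 * c ^ 3 : ℕ) : ℤ) := by
        exact_mod_cast hsum
      push_cast at hsum'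
      linear_combination (a : ℤ) ^ 3 * (t.1 : ℤ) ^ 2 * hsq _ h1 + (b : ℤ) ^ 3 * (t.2.1 : ℤ) ^ 2 * hsq _ h2 -
        (c : ℤ) ^ 3 * (t.2.2 : ℤ) ^ 2 * hsq _ h3 + hsum'
    · -- content `1`: `gcd(a t₀, b t₁) = 1`
      have hcop' : Nat.Coprime (a * t.1) (b * t.2.1) := by
        have h := hcop
        refine Nat.Coprime.coprime_dvd_left ⟨t.1 * a ^ 2, by ring⟩ (Nat.Coprime.coprime_dvd_right
          ⟨t.2.1 * b ^ 2, by ring⟩ h)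
      have hg : Int.gcd (ε.1 * (a * t.1 : ℕ)) (ε.2.1 * (b * t.2.1 : ℕ)) = 1 := by
        rw [Int.gcd_eq_natAbs, habs _ h1, habs _ h2]; exact hcop'
      have hdvd := (content3_dvd (ε.1 * (a * t.1 : ℕ), ε.2.1 * (b * t.2.1 : ℕ), ε.2.2 * (c * t.2.2 : ℕ)))
      have : content3 (ε.1 * (a * t.1 : ℕ), ε.2.1 * (b * t.2.1 : ℕ), ε.2.2 * (c * t.2.2 : ℕ)) ∣ 1 := by
        rw [← hg]; exact Int.dvd_gcd hdvd.1 hdvd.2.1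
      exact Nat.dvd_one.1 this
    · exact mul_ne_zero (by rcases h1 with h | h <;> rw [h] <;> norm_num) (by exact_mod_cast mul_ne_zero ha t0.ne')
    · exact mul_ne_zero (by rcases h2 with h | h <;> rw [h] <;> norm_num) (by exact_mod_cast mul_ne_zero hb t1.ne')
    · exact mul_ne_zero (by rcases h3 with h | h <;> rw [h] <;> norm_num) (by exact_mod_cast mul_ne_zero hc t2.ne')
    · push_cast
      have hB' : ((t.2.2 ^ 2 * c ^ 3 : ℕ) : ℤ) ≤ (B : ℤ) := by exact_mod_cast hB
      push_cast at hB'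
      nlinarith [hsq _ h3]
  -- (2) `Φ` is injective on `Signs × T`
  have hinj : Set.InjOn Φ (Signs ×ˢ T) := by
    rintro ⟨ε, t⟩ ⟨hε, ht⟩ ⟨ε', t'⟩ ⟨hε', ht'⟩ heq
    obtain ⟨h1, h2, h3⟩ := hε
    obtain ⟨h1', h2', h3'⟩ := hε'
    obtain ⟨⟨p0, p1, hsum, -⟩, -⟩ := ht
    simp only at p0 p1 hsum
    have t0 : 0 < t.1 := Nat.pos_of_ne_zero fun h => by simp [h] at p0
    have t1 : 0 < t.2.1 := Nat.pos_of_ne_zero fun h => by simp [h] at p1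
    have t2 : 0 < t.2.2 := Nat.pos_of_ne_zero fun h => by
      rw [h] at hsum; simp at hsum; omega
    simp only [hΦ, Prod.mk.injEq] at heq
    obtain ⟨e0, e1, e2⟩ := heq
    -- absolute values give `t = t'`, then signs agree
    have key : ∀ (e e' : ℤ) (k n n' : ℕ), (e = 1 ∨ e = -1) → (e' = 1 ∨ e' = -1) → k ≠ 0 → 0 < n →
        e * (k * n : ℕ) = e' * (k * n' : ℕ) → n = n' ∧ e = e' := by
      intro e e' k n n' he he' hk hn h
      have hab := congr_arg Int.natAbs h
      rw [habs _ he, habs _ he'] at hab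
      have hn' : n = n' := Nat.eq_of_mul_eq_mul_left (Nat.pos_of_ne_zero hk) hab
      subst hn'
      refine ⟨rfl, ?_⟩
      have hne : ((k * n : ℕ) : ℤ) ≠ 0 := by exact_mod_cast mul_ne_zero hk hn.ne'
      exact mul_right_cancel₀ hne h
    obtain ⟨f0, g0⟩ := key _ _ _ _ _ h1 h1' ha t0 e0
    obtain ⟨f1, g1⟩ := key _ _ _ _ _ h2 h2' hb t1 e1
    obtain ⟨f2, g2⟩ := key _ _ _ _ _ h3 h3' hc t2 e2
    exact Prod.ext (Prod.ext g0 (Prod.ext g1 g2)) (Prod.ext f0 (Prod.ext f1 f2))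
  -- (3) `Φ` maps onto `S`
  have honto : S ⊆ Φ '' (Signs ×ˢ T) := by
    intro x hx
    obtain ⟨hF, hxc, n0, n1, n2, ⟨k0, hk0⟩, ⟨k1, hk1⟩, ⟨k2, hk2⟩, hB⟩ := hx
    have hsign : ∀ z : ℤ, z ≠ 0 → (z.sign = 1 ∨ z.sign = -1) := fun z hz => by
      rcases lt_or_gt_of_ne hz with h | h
      · exact Or.inr (Int.sign_eq_neg_one_of_neg h)
      · exact Or.inl (Int.sign_eq_one_of_pos h)
    refine ⟨((x.1.sign, x.2.1.sign, x.2.2.sign), (k0.natAbs, k1.natAbs, k2.natAbs)),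
      ⟨⟨hsign _ n0, hsign _ n1, hsign _ n2⟩, ?_⟩, ?_⟩
    · -- `(|k₀|, |k₁|, |k₂|) ∈ conicTriples`
      have hk0' : k0 ≠ 0 := by rintro rfl; rw [mul_zero] at hk0; exact n0 hk0
      have hk1' : k1 ≠ 0 := by rintro rfl; rw [mul_zero] at hk1; exact n1 hk1
      have hk2' : k2 ≠ 0 := by rintro rfl; rw [mul_zero] at hk2; exact n2 hk2
      have hcopZ := isCoprime_of_primitive_zero hd hF hxc
      rw [hk0, hk1] at hcopZ
      simp only [ternForm] at hF
      rw [hk0, hk1, hk2] at hF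
      refine ⟨⟨by positivity, by positivity, ?_, ?_⟩, ?_⟩
      · -- the sum, from `F = 0`
        have e : ((k0.natAbs ^ 2 * a ^ 3 + k1.natAbs ^ 2 * b ^ 3 : ℕ) : ℤ) = ((k2.natAbs ^ 2 * c ^ 3 : ℕ) : ℤ) := by
          push_cast
          rw [sq_abs, sq_abs, sq_abs]
          linear_combination hF
        exact_mod_cast e
      · -- coprimality, from `gcd(aX², bY²) = 1`
        have e : IsCoprime (((k0.natAbs ^ 2 * a ^ 3 : ℕ)) : ℤ) (((k1.natAbs ^ 2 * b ^ 3 : ℕ)) : ℤ) := by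
          push_cast
          rw [sq_abs, sq_abs]
          have e1 : (k0 : ℤ) ^ 2 * (a : ℤ) ^ 3 = (a : ℤ) * ((a : ℤ) * k0) ^ 2 := by ring
          have e2 : (k1 : ℤ) ^ 2 * (b : ℤ) ^ 3 = (b : ℤ) * ((b : ℤ) * k1) ^ 2 := by ring
          rw [e1, e2]; exact hcopZ
        exact Nat.isCoprime_iff_coprime.1 e
      · -- the height
        have : ((k2.natAbs ^ 2 * c ^ 3 : ℕ) : ℤ) ≤ (B : ℤ) := by
          push_cast
          rw [sq_abs]
          rw [hk2] at hB
          nlinarith [hB]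
        exact_mod_cast this
    · -- `Φ(sign x, |k|) = x`
      have key : ∀ (z k : ℤ) (m : ℕ), z = m * k → z.sign * ((m * k.natAbs : ℕ) : ℤ) = z := by
        intro z k m hz
        subst hz
        push_cast
        rcases Nat.eq_zero_or_pos m with rfl | hm
        · simp
        · rw [Int.sign_mul, Int.sign_eq_one_of_pos (by exact_mod_cast hm : (0 : ℤ) < m), one_mul,
            mul_left_comm, Int.sign_mul_abs]
      simp only [hΦ]
      exact Prod.ext (key _ _ _ hk0) (Prod.ext (key _ _ _ hk1) (key _ _ _ hk2))
  have himage : Φ '' (Signs ×ˢ T) = S :=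
    Set.Subset.antisymm (by rintro _ ⟨q, hq, rfl⟩; exact hinto q hq) honto
  rw [← himage, hinj.ncard_image, Set.ncard_prod, hSigns, ncard_signs]


end Literature.NumberTheory.DiophantineGeometry
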